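import Summits.QuantumFields.YangMills.Theorems.QuantileBitPurityGAxisLadder
import HarnessLib

/-!
# The comb-transported plane links of one slice

Support module (`--supports` stmt-QuantumFields-23948, `QuantileBitPurity.HolonomyQuantileSubQuartic`; seat ym-dw-p1 g16, plan HOME
`bc/g15-dw/PLAN-CORE-GAXIS.md`, module S1, second half).  On one slice `U` of the spatial torus `(ℤ/L)³` with `SU(2)` links (`q = su2Quat`), under
a uniform plaquette bound `‖q(U_p) − 1‖ ≤ ε`, with the COMB TRANSPORT `W_x = lineHolonomy U 2 x₂ 0 · lineHolonomy U 1 x₁ (x₂ e₂)` from the origin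
to the plane site `x = (0, x₁, x₂)` (column along `e₂`, then row along `e₁`; representatives `ZMod.val`), the TRANSPORTED PLANE LINK
`V = W_x · U(x, j) · W_{x+e_j}⁻¹` (`j = 1, 2`) is

* EXACTLY `1` on the comb `y`-edges (`combLink_one_eq_one`);
* within `x₂ L ε` of the `y`-holonomy `P_y(0) = lineHolonomy U 1 L 0` on the wrapping `y`-edges (column ladder; `norm_combLink_one_sub_polY_le`);
* within `x₁ ε` of `1` on the `z`-edges below the top (rectangle holonomy; `norm_combLink_two_sub_one_le`);
* within `x₁ ε` of the `z`-holonomy `P_z(0) = lineHolonomy U 2 L 0` on the wrapping `z`-edges (`norm_combLink_two_sub_polZ_le`);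

hence ★ `norm_comm_combLink_le`: for EVERY `a ∈ SU(2)`, `‖q_a q_V − q_V q_a‖ ≤ max(‖q_a q_{P_y} − q_{P_y} q_a‖, ‖q_a q_{P_z} − q_{P_z} q_a‖) + 2 L²ε ‖q_a − 1‖`
— the edge defect of a comb-transported rotation field is controlled by the commutators of the reference rotation with the two holonomies through
the origin.

HONEST FRAMING: fixed-lattice bookkeeping; nothing about infinite volume, the continuum limit or the Clay gap.  No `sorry`, no new axiom, no new
definition.  References: [cite: Luscher1983, §2]; [cite: Wilson1974].
-/

set_option autoImplicit false

noncomputable section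

open scoped Quaternion BigOperators
open NormedSpace Function
open Literature.MathematicalPhysics.QuantumLattice (su2Quat su2Quat_ne_zero norm_su2Quat)
open Literature.MathematicalPhysics.QuantumFieldTheory hiding su2Quat_mul
open Literature.MathematicalPhysics.QuantumFieldTheory.Balaban1983to89.T4HaarSU2Translate (su2Quat_mul su2Quat_one)

namespace Summit.QuantumFields.YangMills.Theorems.FemtoTransferGap.GAxis

open ClassShift OwnAxis

variable {L : ℕ}

/-! ## §3 The comb-transported plane links -/

section Comb

variable [NeZero L]

omit [NeZero L] in
/-- A plane site is its column base plus its row offset: `x = x₂ e₂ + x₁ e₁` for `x₀ = 0`. [folklore] -/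
theorem plane_site_eq {x : Site 3 L} (hx : x 0 = 0) : x = Pi.single 2 (x 2) + Pi.single 1 (x 1) := by
  funext k
  fin_cases k
  · simp [hx]
  · simp
  · simp

/-- The plane site reached from its column base by `x₁` row steps. [folklore] -/
theorem plane_site_eq_iterate_row {x : Site 3 L} (hx : x 0 = 0) :
    (fun y : Site 3 L => y.shift 1)^[(x 1).val] (Pi.single 2 (x 2)) = x := by
  rw [iterate_shift_dir_eq, ZMod.natCast_zmod_val, ← plane_site_eq hx]

/-- The column base as the end of the column from the origin: `x₂ e₂ = 0 + x₂.val • e₂`. [folklore] -/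
theorem column_base_eq (x : Site 3 L) : (0 : Site 3 L) + Pi.single 2 (((x 2).val : ℕ) : ZMod L) = Pi.single 2 (x 2) := by
  rw [ZMod.natCast_zmod_val, zero_add]

/-- The successor of a coordinate: `a + 1 = ((a.val + 1 : ℕ) : ZMod L)`. [folklore] -/
theorem coord_add_one_eq (a : ZMod L) : a + 1 = (((a.val + 1 : ℕ) : ℕ) : ZMod L) := by
  rw [Nat.cast_succ, ZMod.natCast_zmod_val]

/-- Below the top, the successor has the successor representative. [folklore] -/
theorem val_add_one_of_lt {a : ZMod L} (h : a.val + 1 < L) : (a + 1).val = a.val + 1 := by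
  rw [coord_add_one_eq, ZMod.val_natCast, Nat.mod_eq_of_lt h]

/-- At the top, the successor wraps to `0`. [folklore] -/
theorem add_one_eq_zero_of_eq {a : ZMod L} (h : a.val + 1 = L) : a + 1 = 0 := by
  rw [coord_add_one_eq, h, ZMod.natCast_self]

/-- The row holonomy extended by the next row link: `R_{x₂,x₁} · U(x,1) = lineHolonomy U 1 (x₁+1) (x₂ e₂)`. [folklore] -/
theorem row_mul_link_eq (U : GaugeConfig 3 L SU2) {x : Site 3 L} (hx : x 0 = 0) :
    lineHolonomy U 1 (x 1).val (Pi.single 2 (x 2)) * U (x, 1) = lineHolonomy U 1 ((x 1).val + 1) (Pi.single 2 (x 2)) := by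
  rw [WilsonLoopRP.lineHolonomy_succ_right, ZMod.natCast_zmod_val, ← plane_site_eq hx]

/-- The column holonomy extended by the next column link: `C_{x₂} · U(x₂e₂, 2) = lineHolonomy U 2 (x₂+1) 0`. [folklore] -/
theorem column_mul_link_eq (U : GaugeConfig 3 L SU2) (x : Site 3 L) :
    lineHolonomy U 2 (x 2).val 0 * U (Pi.single 2 (x 2), 2) = lineHolonomy U 2 ((x 2).val + 1) 0 := by
  rw [WilsonLoopRP.lineHolonomy_succ_right, column_base_eq]

/-- ★ **Comb `y`-edge below the top**: the transported link is EXACTLY `1`. [cite: Luscher1983, §2] -/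
theorem combLink_one_eq_one (U : GaugeConfig 3 L SU2) {x : Site 3 L} (hx : x 0 = 0) (hy : (x 1).val + 1 < L) :
    (lineHolonomy U 2 (x 2).val 0 * lineHolonomy U 1 (x 1).val (Pi.single 2 (x 2))) * U (x, 1) *
      (lineHolonomy U 2 ((x.shift 1) 2).val 0 * lineHolonomy U 1 ((x.shift 1) 1).val (Pi.single 2 ((x.shift 1) 2)))⁻¹ = 1 := by
  have h2 : (x.shift 1) 2 = x 2 := by simp [Site.shift]
  have h1 : ((x.shift 1) 1).val = (x 1).val + 1 := by
    have : (x.shift 1) 1 = x 1 + 1 := by simp [Site.shift]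
    rw [this, val_add_one_of_lt hy]
  rw [h2, h1, mul_assoc (lineHolonomy U 2 (x 2).val 0), row_mul_link_eq U hx, mul_inv_cancel]

/-- ★ **Wrapping `y`-edge**: the transported link is the column conjugate of the `y`-holonomy based at `x₂ e₂`, within `x₂ L ε` of the `y`-holonomy
through the origin. [cite: Luscher1983, §2] -/
theorem norm_combLink_one_sub_polY_le {U : GaugeConfig 3 L SU2} {ε : ℝ}
    (hP : ∀ (y : Site 3 L) (i j : Fin 3), ‖su2Quat (plaquetteHolonomy U y i j) - 1‖ ≤ ε) {x : Site 3 L} (hx : x 0 = 0) (hy : (x 1).val + 1 = L) :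
    ‖su2Quat ((lineHolonomy U 2 (x 2).val 0 * lineHolonomy U 1 (x 1).val (Pi.single 2 (x 2))) * U (x, 1) *
        (lineHolonomy U 2 ((x.shift 1) 2).val 0 * lineHolonomy U 1 ((x.shift 1) 1).val (Pi.single 2 ((x.shift 1) 2)))⁻¹) -
      su2Quat (lineHolonomy U 1 L 0)‖ ≤ (x 2).val * (L * ε) := by
  have h2 : (x.shift 1) 2 = x 2 := by simp [Site.shift]
  have h1 : ((x.shift 1) 1).val = 0 := by
    have : (x.shift 1) 1 = x 1 + 1 := by simp [Site.shift]
    rw [this, add_one_eq_zero_of_eq hy, ZMod.val_zero]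
  rw [h2, h1, mul_assoc (lineHolonomy U 2 (x 2).val 0), row_mul_link_eq U hx, hy]
  simp only [lineHolonomy, mul_one]
  have h := norm_su2Quat_column_conj_sub_le hP 1 2 (x 2).val (0 : Site 3 L)
  rw [column_base_eq] at h
  exact h

/-- The rectangle of the non-comb `z`-edge at `x`: `R_{x₂,x₁} · U(x,2) · R_{x₂+1,x₁}⁻¹ = M · U(x₂e₂, 2)` with `‖q_M − 1‖ ≤ x₁ ε`. [cite: Wilson1974] -/
theorem norm_rectangle_sub_one_le {U : GaugeConfig 3 L SU2} {ε : ℝ}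
    (hP : ∀ (y : Site 3 L) (i j : Fin 3), ‖su2Quat (plaquetteHolonomy U y i j) - 1‖ ≤ ε) {x : Site 3 L} (hx : x 0 = 0) :
    ‖su2Quat (lineHolonomy U 1 (x 1).val (Pi.single 2 (x 2)) * U (x, 2) * (lineHolonomy U 1 (x 1).val (Site.shift (Pi.single 2 (x 2) : Site 3 L) 2))⁻¹ *
        (U (Pi.single 2 (x 2), 2))⁻¹) - 1‖ ≤ (x 1).val * ε := by
  set b : Site 3 L := Pi.single 2 (x 2) with hb
  set R := lineHolonomy U 1 (x 1).val b with hR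
  set R' := lineHolonomy U 1 (x 1).val (b.shift 2) with hR'
  -- the open transport lemma: `T = U(b,2) R' U(x,2)⁻¹` is `x₁ ε`-close to `R`
  have hT := norm_su2Quat_transportDir_sub_le U 1 2 (x 1).val b
  rw [plane_site_eq_iterate_row hx] at hT
  have hT' : ‖su2Quat (U (b, 2) * R' * (U (x, 2))⁻¹) - su2Quat R‖ ≤ (x 1).val * ε :=
    hT.trans ((Finset.sum_le_card_nsmul _ _ _ fun m _ => hP _ _ _).trans (by simp))
  -- `R U(x,2) R'⁻¹ U(b,2)⁻¹ = (U(b,2) R' U(x,2)⁻¹ · R⁻¹)⁻¹`, and `‖q_{M} − 1‖ = ‖q_{M⁻¹} − 1‖ = ‖q_T − q_R‖`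
  have hM : R * U (x, 2) * R'⁻¹ * (U (b, 2))⁻¹ = (U (b, 2) * R' * (U (x, 2))⁻¹ * R⁻¹)⁻¹ := by group
  rw [hM]
  have hinv : ∀ M : SU2, ‖su2Quat M⁻¹ - 1‖ = ‖su2Quat M - 1‖ := fun M => by
    have h := norm_su2Quat_sub_eq (1 : SU2) M
    rw [su2Quat_one, one_mul, norm_sub_rev] at h
    exact h.symm
  rw [hinv, ← norm_su2Quat_sub_eq]
  exact hT'

/-- ★ **Non-comb `z`-edge below the top**: the transported link is within `x₁ ε` of `1`. [cite: Luscher1983, §2] -/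
theorem norm_combLink_two_sub_one_le {U : GaugeConfig 3 L SU2} {ε : ℝ}
    (hP : ∀ (y : Site 3 L) (i j : Fin 3), ‖su2Quat (plaquetteHolonomy U y i j) - 1‖ ≤ ε) {x : Site 3 L} (hx : x 0 = 0) (hz : (x 2).val + 1 < L) :
    ‖su2Quat ((lineHolonomy U 2 (x 2).val 0 * lineHolonomy U 1 (x 1).val (Pi.single 2 (x 2))) * U (x, 2) *
        (lineHolonomy U 2 ((x.shift 2) 2).val 0 * lineHolonomy U 1 ((x.shift 2) 1).val (Pi.single 2 ((x.shift 2) 2)))⁻¹) - 1‖ ≤ (x 1).val * ε := by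
  have h1 : (x.shift 2) 1 = x 1 := by simp [Site.shift]
  have h2v : ((x.shift 2) 2).val = (x 2).val + 1 := by
    have : (x.shift 2) 2 = x 2 + 1 := by simp [Site.shift]
    rw [this, val_add_one_of_lt hz]
  have hb' : (Pi.single 2 ((x.shift 2) 2) : Site 3 L) = Site.shift (Pi.single 2 (x 2) : Site 3 L) 2 := by
    have : (x.shift 2) 2 = x 2 + 1 := by simp [Site.shift]
    rw [this, Site.shift, ← Pi.single_add]
  rw [h1, h2v, hb', ← column_mul_link_eq U x]
  set C := lineHolonomy U 2 (x 2).val 0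
  set b : Site 3 L := Pi.single 2 (x 2)
  set R := lineHolonomy U 1 (x 1).val b
  set R' := lineHolonomy U 1 (x 1).val (b.shift 2)
  have hconj : C * R * U (x, 2) * (C * U (b, 2) * R')⁻¹ = C * (R * U (x, 2) * R'⁻¹ * (U (b, 2))⁻¹) * C⁻¹ := by group
  rw [hconj]
  have hiso := norm_su2Quat_conj_sub_conj' C (R * U (x, 2) * R'⁻¹ * (U (b, 2))⁻¹) 1
  rw [mul_one, mul_inv_cancel, su2Quat_one] at hiso
  rw [hiso]
  exact norm_rectangle_sub_one_le hP hx

/-- ★ **Wrapping `z`-edge**: the transported link is within `x₁ ε` of the `z`-holonomy through the origin. [cite: Luscher1983, §2] -/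
theorem norm_combLink_two_sub_polZ_le {U : GaugeConfig 3 L SU2} {ε : ℝ}
    (hP : ∀ (y : Site 3 L) (i j : Fin 3), ‖su2Quat (plaquetteHolonomy U y i j) - 1‖ ≤ ε) {x : Site 3 L} (hx : x 0 = 0) (hz : (x 2).val + 1 = L) :
    ‖su2Quat ((lineHolonomy U 2 (x 2).val 0 * lineHolonomy U 1 (x 1).val (Pi.single 2 (x 2))) * U (x, 2) *
        (lineHolonomy U 2 ((x.shift 2) 2).val 0 * lineHolonomy U 1 ((x.shift 2) 1).val (Pi.single 2 ((x.shift 2) 2)))⁻¹) -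
      su2Quat (lineHolonomy U 2 L 0)‖ ≤ (x 1).val * ε := by
  have h1 : (x.shift 2) 1 = x 1 := by simp [Site.shift]
  have h2v : ((x.shift 2) 2).val = 0 := by
    have : (x.shift 2) 2 = x 2 + 1 := by simp [Site.shift]
    rw [this, add_one_eq_zero_of_eq hz, ZMod.val_zero]
  have hb' : (Pi.single 2 ((x.shift 2) 2) : Site 3 L) = Site.shift (Pi.single 2 (x 2) : Site 3 L) 2 := by
    have : (x.shift 2) 2 = x 2 + 1 := by simp [Site.shift]
    rw [this, Site.shift, ← Pi.single_add]
  have hPz : lineHolonomy U 2 L 0 = lineHolonomy U 2 (x 2).val 0 * U (Pi.single 2 (x 2), 2) := by rw [column_mul_link_eq U x, hz]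
  rw [h1, h2v, hb', hPz]
  simp only [lineHolonomy, one_mul]
  set C := lineHolonomy U 2 (x 2).val 0
  set b : Site 3 L := Pi.single 2 (x 2)
  set R := lineHolonomy U 1 (x 1).val b
  set R' := lineHolonomy U 1 (x 1).val (b.shift 2)
  -- `C R U R'⁻¹ = [C M C⁻¹] · (C U(b,2))` with `M` the rectangle
  have hfac : C * R * U (x, 2) * R'⁻¹ = C * (R * U (x, 2) * R'⁻¹ * (U (b, 2))⁻¹) * C⁻¹ * (C * U (b, 2)) := by group
  rw [hfac, su2Quat_mul (C * (R * U (x, 2) * R'⁻¹ * (U (b, 2))⁻¹) * C⁻¹)]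
  have hn : ‖su2Quat (C * U (b, 2))‖ = 1 := norm_su2Quat _
  have e : su2Quat (C * (R * U (x, 2) * R'⁻¹ * (U (b, 2))⁻¹) * C⁻¹) * su2Quat (C * U (b, 2)) - su2Quat (C * U (b, 2)) =
      (su2Quat (C * (R * U (x, 2) * R'⁻¹ * (U (b, 2))⁻¹) * C⁻¹) - 1) * su2Quat (C * U (b, 2)) := by noncomm_ring
  rw [e, norm_mul, hn, mul_one]
  have hiso := norm_su2Quat_conj_sub_conj' C (R * U (x, 2) * R'⁻¹ * (U (b, 2))⁻¹) 1
  rw [mul_one, mul_inv_cancel, su2Quat_one] at hiso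
  rw [hiso]
  exact norm_rectangle_sub_one_le hP hx

/-- **Comb `z`-edges at `x₁ = 0`** are covered by the previous two lemmas (`x₁ ε = 0`); for bookkeeping we record that every bound above is `≤ L²ε`.
[folklore] -/
theorem val_mul_le_sq_mul {ε : ℝ} (hε : 0 ≤ ε) (a : ZMod L) : (a.val : ℝ) * ε ≤ L * (L * ε) := by
  have ha : (a.val : ℝ) ≤ L := by exact_mod_cast (ZMod.val_lt a).le
  have hL1 : (1 : ℝ) ≤ L := by exact_mod_cast NeZero.one_le
  calc (a.val : ℝ) * ε ≤ L * ε := mul_le_mul_of_nonneg_right ha hε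
    _ = L * (1 * ε) := by ring
    _ ≤ L * (L * ε) := mul_le_mul_of_nonneg_left (mul_le_mul_of_nonneg_right hL1 hε) (by positivity)

/-- ★ **The commutator of ANY element with a comb-transported plane link**: for a plane site `x`, `j ≠ 0` and every `a ∈ SU(2)`,
`‖q_a q_V − q_V q_a‖ ≤ max(‖q_a q_{P_y} − q_{P_y} q_a‖, ‖q_a q_{P_z} − q_{P_z} q_a‖) + 2 (L² ε) ‖q_a − 1‖`, `V` the transported link,
`P_y = lineHolonomy U 1 L 0`, `P_z = lineHolonomy U 2 L 0`. [cite: Luscher1983, §2] -/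
theorem norm_comm_combLink_le {U : GaugeConfig 3 L SU2} {ε : ℝ}
    (hP : ∀ (y : Site 3 L) (i j : Fin 3), ‖su2Quat (plaquetteHolonomy U y i j) - 1‖ ≤ ε) (a : SU2) {x : Site 3 L} (hx : x 0 = 0)
    {j : Fin 3} (hj : j ≠ 0) :
    ‖su2Quat a * su2Quat ((lineHolonomy U 2 (x 2).val 0 * lineHolonomy U 1 (x 1).val (Pi.single 2 (x 2))) * U (x, j) *
          (lineHolonomy U 2 ((x.shift j) 2).val 0 * lineHolonomy U 1 ((x.shift j) 1).val (Pi.single 2 ((x.shift j) 2)))⁻¹) -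
        su2Quat ((lineHolonomy U 2 (x 2).val 0 * lineHolonomy U 1 (x 1).val (Pi.single 2 (x 2))) * U (x, j) *
          (lineHolonomy U 2 ((x.shift j) 2).val 0 * lineHolonomy U 1 ((x.shift j) 1).val (Pi.single 2 ((x.shift j) 2)))⁻¹) * su2Quat a‖ ≤
      max ‖su2Quat a * su2Quat (lineHolonomy U 1 L 0) - su2Quat (lineHolonomy U 1 L 0) * su2Quat a‖
          ‖su2Quat a * su2Quat (lineHolonomy U 2 L 0) - su2Quat (lineHolonomy U 2 L 0) * su2Quat a‖ +
        2 * (L * (L * ε)) * ‖su2Quat a - 1‖ := by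
  have hε : 0 ≤ ε := (norm_nonneg _).trans (hP 0 0 1)
  set V := (lineHolonomy U 2 (x 2).val 0 * lineHolonomy U 1 (x 1).val (Pi.single 2 (x 2))) * U (x, j) *
    (lineHolonomy U 2 ((x.shift j) 2).val 0 * lineHolonomy U 1 ((x.shift j) 1).val (Pi.single 2 ((x.shift j) 2)))⁻¹ with hV
  set M := max ‖su2Quat a * su2Quat (lineHolonomy U 1 L 0) - su2Quat (lineHolonomy U 1 L 0) * su2Quat a‖
    ‖su2Quat a * su2Quat (lineHolonomy U 2 L 0) - su2Quat (lineHolonomy U 2 L 0) * su2Quat a‖ with hM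
  have hM0 : 0 ≤ M := le_max_of_le_left (norm_nonneg _)
  -- generic step: a reference element `R` with `‖q_V − q_R‖ ≤ δ ≤ L²ε` and `‖[a,R]‖ ≤ M`
  have key : ∀ (R : SU2) {δ : ℝ}, ‖su2Quat V - su2Quat R‖ ≤ δ → δ ≤ L * (L * ε) →
      ‖su2Quat a * su2Quat R - su2Quat R * su2Quat a‖ ≤ M →
      ‖su2Quat a * su2Quat V - su2Quat V * su2Quat a‖ ≤ M + 2 * (L * (L * ε)) * ‖su2Quat a - 1‖ := by
    intro R δ hδ hδL hR
    have h1 : ‖su2Quat a * su2Quat V - su2Quat V * su2Quat a‖ ≤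
        ‖su2Quat a * su2Quat R - su2Quat R * su2Quat a‖ + ‖(su2Quat a * su2Quat V - su2Quat V * su2Quat a) - (su2Quat a * su2Quat R - su2Quat R * su2Quat a)‖ := by
      have := norm_add_le (su2Quat a * su2Quat R - su2Quat R * su2Quat a)
        ((su2Quat a * su2Quat V - su2Quat V * su2Quat a) - (su2Quat a * su2Quat R - su2Quat R * su2Quat a))
      rwa [add_sub_cancel] at this
    have h2 : ‖(su2Quat a * su2Quat V - su2Quat V * su2Quat a) - (su2Quat a * su2Quat R - su2Quat R * su2Quat a)‖ ≤ 2 * ‖su2Quat V - su2Quat R‖ * ‖su2Quat a - 1‖ := by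
      have e : (su2Quat a * su2Quat V - su2Quat V * su2Quat a) - (su2Quat a * su2Quat R - su2Quat R * su2Quat a) =
          (su2Quat a - 1) * (su2Quat V - su2Quat R) - (su2Quat V - su2Quat R) * (su2Quat a - 1) := by noncomm_ring
      rw [e]
      calc _ ≤ ‖(su2Quat a - 1) * (su2Quat V - su2Quat R)‖ + ‖(su2Quat V - su2Quat R) * (su2Quat a - 1)‖ := norm_sub_le _ _
        _ ≤ ‖su2Quat a - 1‖ * ‖su2Quat V - su2Quat R‖ + ‖su2Quat V - su2Quat R‖ * ‖su2Quat a - 1‖ := add_le_add (norm_mul_le _ _) (norm_mul_le _ _)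
        _ = 2 * ‖su2Quat V - su2Quat R‖ * ‖su2Quat a - 1‖ := by ring
    have h3 : 2 * ‖su2Quat V - su2Quat R‖ * ‖su2Quat a - 1‖ ≤ 2 * (L * (L * ε)) * ‖su2Quat a - 1‖ :=
      mul_le_mul_of_nonneg_right (by linarith) (norm_nonneg _)
    linarith
  -- the four edge types
  by_cases hj1 : j = 1
  · subst hj1
    by_cases hy : (x 1).val + 1 < L
    · have hV1 : V = 1 := combLink_one_eq_one U hx hy
      refine key 1 (δ := 0) (by rw [hV1, sub_self, norm_zero]) (by positivity) ?_
      rw [su2Quat_one, mul_one, one_mul, sub_self, norm_zero]; exact hM0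
    · have hy' : (x 1).val + 1 = L := by have := ZMod.val_lt (x 1); omega
      exact key (lineHolonomy U 1 L 0) (norm_combLink_one_sub_polY_le hP hx hy')
        ((mul_le_mul_of_nonneg_right (by exact_mod_cast (ZMod.val_lt (x 2)).le) (by positivity))) (le_max_left _ _)
  · have hj2 : j = 2 := by
      fin_cases j
      · exact absurd rfl hj
      · exact absurd rfl hj1
      · rfl
    subst hj2
    by_cases hz : (x 2).val + 1 < L
    · refine key 1 (norm_combLink_two_sub_one_le hP hx hz |>.trans_eq' (by rw [su2Quat_one])) (val_mul_le_sq_mul hε (x 1)) ?_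
      rw [su2Quat_one, mul_one, one_mul, sub_self, norm_zero]; exact hM0
    · have hz' : (x 2).val + 1 = L := by have := ZMod.val_lt (x 2); omega
      exact key (lineHolonomy U 2 L 0) (norm_combLink_two_sub_polZ_le hP hx hz') (val_mul_le_sq_mul hε (x 1)) (le_max_right _ _)

end Comb

end Summit.QuantumFields.YangMills.Theorems.FemtoTransferGap.GAxis

end
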